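import Summits.AnomalousDissipation.AnomalousDissipation.Theorems.MomentParityQuarticGateSignLemma
import Summits.AnomalousDissipation.AnomalousDissipation.Theorems.QuarticGate.Negative.LevelCeiling

/-!
# Line `dissipative-tower` for the crux `QuarticLadder.QuarticGate` — stub T-dict, the frame
# DICTIONARY of "no dissipative tower" (stmt-AnomalousDissipation-11464)

Stub `stub_noTowerDictionary` of the annex `dissipative_tower_core` of the live line
`Lines/dissipative_tower.lean`, statement copied byte-for-byte: the pure-calculus core on `ℝ^ι`
(moment amplification, the first binder of the statement) IMPLIES the fluid statement "no dissipative
tower over a cubic Casimir of level-`N` Galerkin–Euler".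

PROOF. Frame coordinates of the landed sign lemma `MomentParityQuarticGateSignLemma.stub_signLemma`:
`A = Torus.FrameIdx (Fin 3) N`, `e_a = Torus.frameFieldIdx N a`, synthesis `U c = [∑ cₐ e_a] ∈ H`
(`exists_frame_synthesis`), couplings `G j a = ∫⟪g_j, e_a⟫`, rows `Vₐ(c) = ⟨B_N(U c), e_a⟩ =
∑ c_b c_b' T a b b'`, `h(c) = P(G c)`; `hrow`/`hkey`/`hdiv`/`htan` as there. Three dictionary facts
are added: (i) VISCOUS ROWS `⟨F_ν(U c), e_a⟩ = Vₐ(c) + ν ∑_b D a b c_b`, `D a b = ∫⟪Δe_a, e_b⟫`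
(definition of `nsGeneratorPairing`, `integral_inner_synthesis_left`); (ii) COERCIVITY
`4π² ∑ Π a b cₐ c_b = 4π² ‖U c‖² ≤ ‖∇(U c)‖² = -∑ D a b cₐ c_b` with `Π a b = ∫⟪e_a, e_b⟫` the Gram
matrix of the frame (Poincaré `Torus.norm_sq_le_toReal_eGradNormSq`, `P_N (U c) = ∑ cₐ e_a`,
`Torus.integral_inner_laplacian_fourierTruncate`); (iii) EULER THROUGH `Π`:
`∑ₐ (Π c)ₐ ∂ₐh = 3 h` (frame reconstruction `∑ₐ Π a b G j a = G j b` of the band tests and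
`MvPolynomial.IsHomogeneous.sum_X_mul_pderiv`). With these the hypotheses of T are the hypotheses of
the core at `(h, q̂/ν, V, D, Π, 4π², 3)` (`q̂(c) = Q(G' c)`; the tower identity at `u = U c` reads
`∇q̂·V = ν ∇h·(D c)` by the Casimir identity), and `h ≡ 0` transports to level-`N` fields through
`c(u)ₐ = (u, e_a)` (`coe_ae_eq_sum_frame_of_level`).
-/

namespace Summit.AnomalousDissipation.AnomalousDissipation.Theorems.QuarticLadderQuarticGate

open MeasureTheory Filter
open scoped InnerProductSpace RealInnerProductSpace
open Literature.Analysis.FunctionSpaces Literature.Analysis.FluidPDE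
open Summit.AnomalousDissipation.AnomalousDissipation.Theorems.QuarticGate.Negative
open Summit.AnomalousDissipation.AnomalousDissipation.Theorems.MomentParityQuarticGate

set_option linter.dupNamespace false

namespace NoTowerDictionary

/-- **Viscous splitting of the tested generator at a synthesis**: with zero force,
`⟨F_ν(U), g⟩ = ⟨F_0(U), g⟩ + ν ∑_b c_b ∫⟪Δg, e_b⟫` when `U` is represented by `∑ c_b e_b`
(definition of `nsGeneratorPairing` and `integral_inner_synthesis_left`). [folklore] -/
theorem nsGeneratorPairing_visc_synthesis {ι : Type*} [Fintype ι] (ν : ℝ) (c : ι → ℝ)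
    {e : ι → UnitAddTorus (Fin 3) → EuclideanSpace ℝ (Fin 3)} (he : ∀ a, Torus.IsSmooth (e a))
    {U : Torus.energySpace (Fin 3)}
    (hU : (U.1 : UnitAddTorus (Fin 3) → EuclideanSpace ℝ (Fin 3)) =ᵐ[volume] fun x => ∑ a, c a • e a x)
    {g : UnitAddTorus (Fin 3) → EuclideanSpace ℝ (Fin 3)} (hg : Torus.IsSmooth g) :
    Torus.nsGeneratorPairing (d := Fin 3) ν 0 U g =
      Torus.nsGeneratorPairing (d := Fin 3) 0 0 U g +
        ν * ∑ b, c b * ∫ x, ⟪Torus.laplacian g x, e b x⟫_ℝ := by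
  have hsplit : Torus.nsGeneratorPairing (d := Fin 3) ν 0 U g =
      Torus.nsGeneratorPairing (d := Fin 3) 0 0 U g +
        ν * ∫ x, ⟪(U.1 : UnitAddTorus (Fin 3) → EuclideanSpace ℝ (Fin 3)) x, Torus.laplacian g x⟫_ℝ := by
    unfold Torus.nsGeneratorPairing
    ring
  have h2 : ∫ x, ⟪(U.1 : UnitAddTorus (Fin 3) → EuclideanSpace ℝ (Fin 3)) x, Torus.laplacian g x⟫_ℝ =
        ∫ x, ⟪∑ a, c a • e a x, Torus.laplacian g x⟫_ℝ :=
    integral_congr_ae (hU.mono fun x hx => by simp only [hx])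
  rw [hsplit, h2, SignLemma.integral_inner_synthesis_left c (fun a => (he a).continuous)
    hg.laplacian.continuous]

/-- **Frame reconstruction of the couplings** (the Gram matrix of the Parseval frame reproduces
the couplings of a band test): `∑ₐ (∫⟪e_a, e_b⟫) (∫⟪g, e_a⟫) = ∫⟪g, e_b⟫`, from
`g = ∑ₐ (∫⟪g, e_a⟫) e_a` pointwise (`eq_sum_frame_of_bandTest`). [folklore] -/
theorem sum_gram_mul_coupling (N : ℕ) {g : UnitAddTorus (Fin 3) → EuclideanSpace ℝ (Fin 3)}
    (hg : Torus.IsSmooth g ∧ Torus.IsDivFree g ∧ Torus.HasZeroMean g ∧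
      ∀ k ∉ (Torus.freqBall N).erase (0 : Fin 3 → ℤ),
        UnitAddTorus.mFourierCoeff (EuclideanSpace.complexify ∘ g) k = 0)
    (b : Torus.FrameIdx (Fin 3) N) :
    ∑ a, (∫ x, ⟪Torus.frameFieldIdx N a x, Torus.frameFieldIdx N b x⟫_ℝ) *
        ∫ y, ⟪g y, Torus.frameFieldIdx N a y⟫_ℝ = ∫ y, ⟪g y, Torus.frameFieldIdx N b y⟫_ℝ := by
  have he := frameFieldIdx_band N
  have h1 : ∫ y, ⟪g y, Torus.frameFieldIdx N b y⟫_ℝ =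
      ∫ y, ⟪∑ a, (∫ z, ⟪g z, Torus.frameFieldIdx N a z⟫_ℝ) • Torus.frameFieldIdx N a y,
        Torus.frameFieldIdx N b y⟫_ℝ :=
    integral_congr_ae (ae_of_all _ fun y => by
      dsimp only
      rw [← SignLemma.eq_sum_frame_of_bandTest hg y])
  rw [h1, SignLemma.integral_inner_synthesis_left _ (fun a => (he a).1.continuous)
    (he b).1.continuous]
  refine Finset.sum_congr rfl fun a _ => ?_
  rw [mul_comm]
  congr 1
  exact integral_congr_ae (ae_of_all _ fun x => real_inner_comm _ _)

/-- **Euler's identity through a reproducing matrix**: if `∑ₐ Π a b G i a = G i b`, then for `P`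
homogeneous of degree `n` and `h(c) = P(y(c))`, `yⱼ(c) = ∑_b c_b G j b`,
`∑ₐ (Π c)ₐ ∂ₐh(c) = ∑ᵢ yᵢ (∂ᵢP)(y) = n h(c)` (`MvPolynomial.IsHomogeneous.sum_X_mul_pderiv`).
[folklore] -/
theorem sum_gram_mul_fderiv_eval {ι : Type} [Fintype ι] [DecidableEq ι] {m n : ℕ}
    (G : Fin m → ι → ℝ) (Pg : ι → ι → ℝ) (hPg : ∀ i b, ∑ a, Pg a b * G i a = G i b)
    {P : MvPolynomial (Fin m) ℝ} (hP : P.IsHomogeneous n) (c : ι → ℝ) :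
    ∑ a, (∑ b, Pg a b * c b) *
        fderiv ℝ (fun c : ι → ℝ => MvPolynomial.eval (fun j => ∑ b, c b * G j b) P) c
          (Pi.single a 1) =
      (n : ℝ) * MvPolynomial.eval (fun j => ∑ b, c b * G j b) P := by
  have heul : ∑ i, (∑ b, c b * G i b) *
      MvPolynomial.eval (fun j => ∑ b, c b * G j b) (MvPolynomial.pderiv i P) =
        (n : ℝ) * MvPolynomial.eval (fun j => ∑ b, c b * G j b) P := by
    have h := congrArg (MvPolynomial.eval (fun j => ∑ b, c b * G j b)) hP.sum_X_mul_pderiv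
    simpa [map_sum] using h
  rw [← heul]
  simp_rw [(SignLemma.fderiv_eval_linear G P).2 c]
  calc ∑ a, (∑ b, Pg a b * c b) *
        ∑ i, MvPolynomial.eval (fun j => ∑ b, c b * G j b) (MvPolynomial.pderiv i P) * G i a
      = ∑ a, ∑ i, (∑ b, Pg a b * c b) *
          (MvPolynomial.eval (fun j => ∑ b, c b * G j b) (MvPolynomial.pderiv i P) * G i a) := by
        simp_rw [Finset.mul_sum]
    _ = ∑ i, ∑ a, (∑ b, Pg a b * c b) *
          (MvPolynomial.eval (fun j => ∑ b, c b * G j b) (MvPolynomial.pderiv i P) * G i a) :=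
        Finset.sum_comm
    _ = _ := Finset.sum_congr rfl fun i _ => ?_
  set E : ℝ := MvPolynomial.eval (fun j => ∑ b, c b * G j b) (MvPolynomial.pderiv i P)
  calc ∑ a, (∑ b, Pg a b * c b) * (E * G i a)
      = ∑ a, ∑ b, Pg a b * c b * (E * G i a) := by simp_rw [Finset.sum_mul]
    _ = ∑ b, ∑ a, Pg a b * c b * (E * G i a) := Finset.sum_comm
    _ = ∑ b, c b * (∑ a, Pg a b * G i a) * E := by
        refine Finset.sum_congr rfl fun b _ => ?_
        rw [Finset.mul_sum, Finset.sum_mul]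
        exact Finset.sum_congr rfl fun a _ => by ring
    _ = (∑ b, c b * G i b) * E := by
        rw [Finset.sum_mul]
        exact Finset.sum_congr rfl fun b _ => by rw [hPg]

/-- **Coercivity of the viscous rows over the Gram form** (Poincaré on the band):
`4π² ∑ Π a b cₐ c_b = 4π² ‖U‖² ≤ ‖∇U‖² = -∑ (∫⟪Δe_a, e_b⟫) cₐ c_b` for the level-`N` element `U ∈ H`
represented by `∑ cₐ e_a` (`Torus.norm_sq_le_toReal_eGradNormSq`, `P_N U = ∑ cₐ e_a`,
`Torus.integral_inner_laplacian_fourierTruncate`). [folklore] -/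
theorem frame_coercive (N : ℕ) (c : Torus.FrameIdx (Fin 3) N → ℝ) {U : Torus.energySpace (Fin 3)}
    (hUw : (U.1 : UnitAddTorus (Fin 3) → EuclideanSpace ℝ (Fin 3)) =ᵐ[volume]
      fun x => ∑ a, c a • Torus.frameFieldIdx N a x)
    (hUl : ∀ k ∉ (Torus.freqBall N).erase (0 : Fin 3 → ℤ),
      UnitAddTorus.mFourierCoeff (EuclideanSpace.complexify ∘
        (U.1 : UnitAddTorus (Fin 3) → EuclideanSpace ℝ (Fin 3))) k = 0) :
    4 * Real.pi ^ 2 * ∑ a, ∑ b,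
        (∫ x, ⟪Torus.frameFieldIdx N a x, Torus.frameFieldIdx N b x⟫_ℝ) * c a * c b ≤
      -∑ a, ∑ b, (∫ x, ⟪Torus.laplacian (Torus.frameFieldIdx N a) x,
        Torus.frameFieldIdx N b x⟫_ℝ) * c a * c b := by
  have he := frameFieldIdx_band N
  have hw := sum_smul_frameFieldIdx_band N c
  have hcont : ∀ a, Continuous (Torus.frameFieldIdx N a) := fun a => (he a).1.continuous
  have hv1 : Integrable (U.1 : UnitAddTorus (Fin 3) → EuclideanSpace ℝ (Fin 3)) volume :=
    (Lp.memLp _).integrable one_le_two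
  -- the Gram form is `‖U‖²`
  have hP : ∑ a, ∑ b, (∫ x, ⟪Torus.frameFieldIdx N a x, Torus.frameFieldIdx N b x⟫_ℝ) * c a * c b =
      ‖U‖ ^ 2 := by
    have h1 : ∫ x, ⟪∑ a, c a • Torus.frameFieldIdx N a x, ∑ a, c a • Torus.frameFieldIdx N a x⟫_ℝ =
        ∑ a, c a * ∑ b, c b * ∫ x, ⟪Torus.frameFieldIdx N a x, Torus.frameFieldIdx N b x⟫_ℝ := by
      rw [SignLemma.integral_inner_synthesis_left c hcont hw.1.continuous]
      exact Finset.sum_congr rfl fun a _ => by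
        rw [SignLemma.integral_inner_synthesis_left c hcont (hcont a)]
    have h2 : ∫ x, ⟪∑ a, c a • Torus.frameFieldIdx N a x, ∑ a, c a • Torus.frameFieldIdx N a x⟫_ℝ =
        ‖U‖ ^ 2 := by
      rw [Submodule.coe_norm, ← Torus.integral_norm_sq_coe_eq]
      exact integral_congr_ae (hUw.mono fun x hx => by simp only [hx, real_inner_self_eq_norm_sq])
    rw [← h2, h1]
    refine Finset.sum_congr rfl fun a _ => ?_
    rw [Finset.mul_sum]
    exact Finset.sum_congr rfl fun b _ => by ring
  -- the viscous form is `∫⟪w, Δw⟫` for the representative `w = ∑ cₐ e_a`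
  have hlapw : Torus.laplacian (fun x => ∑ a, c a • Torus.frameFieldIdx N a x) =
      fun x => ∑ a, c a • Torus.laplacian (Torus.frameFieldIdx N a) x :=
    funext fun x => Torus.laplacian_sum_smul Finset.univ c (fun a _ => (he a).1) x
  have hcontΔ : Continuous fun x => ∑ a, c a • Torus.laplacian (Torus.frameFieldIdx N a) x := by
    rw [← hlapw]
    exact hw.1.laplacian.continuous
  have hcomm : ∀ a b : Torus.FrameIdx (Fin 3) N,
      ∫ x, ⟪Torus.laplacian (Torus.frameFieldIdx N a) x, Torus.frameFieldIdx N b x⟫_ℝ =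
        ∫ x, ⟪Torus.frameFieldIdx N b x, Torus.laplacian (Torus.frameFieldIdx N a) x⟫_ℝ :=
    fun a b => integral_congr_ae (ae_of_all _ fun x => real_inner_comm _ _)
  have hD : ∑ a, ∑ b, (∫ x, ⟪Torus.laplacian (Torus.frameFieldIdx N a) x,
      Torus.frameFieldIdx N b x⟫_ℝ) * c a * c b =
        ∫ x, ⟪∑ a, c a • Torus.frameFieldIdx N a x,
          Torus.laplacian (fun x => ∑ a, c a • Torus.frameFieldIdx N a x) x⟫_ℝ := by
    calc ∑ a, ∑ b, (∫ x, ⟪Torus.laplacian (Torus.frameFieldIdx N a) x,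
          Torus.frameFieldIdx N b x⟫_ℝ) * c a * c b
        = ∑ b, ∑ a, (∫ x, ⟪Torus.laplacian (Torus.frameFieldIdx N a) x,
            Torus.frameFieldIdx N b x⟫_ℝ) * c a * c b := Finset.sum_comm
      _ = ∑ b, c b * ∑ a, c a * ∫ x, ⟪Torus.frameFieldIdx N b x,
            Torus.laplacian (Torus.frameFieldIdx N a) x⟫_ℝ := by
          refine Finset.sum_congr rfl fun b _ => ?_
          rw [Finset.mul_sum]
          exact Finset.sum_congr rfl fun a _ => by rw [hcomm]; ring
      _ = ∑ b, c b * ∫ x, ⟪∑ a, c a • Torus.laplacian (Torus.frameFieldIdx N a) x,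
            Torus.frameFieldIdx N b x⟫_ℝ :=
          Finset.sum_congr rfl fun b _ => by
            rw [SignLemma.integral_inner_synthesis_left c
              (fun a => (he a).1.laplacian.continuous) (hcont b)]
      _ = ∫ x, ⟪∑ a, c a • Torus.frameFieldIdx N a x,
            ∑ a, c a • Torus.laplacian (Torus.frameFieldIdx N a) x⟫_ℝ := by
          rw [SignLemma.integral_inner_synthesis_left c hcont hcontΔ]
      _ = _ := by rw [hlapw]
  -- `∫⟪w, Δw⟫ = -‖∇U‖²`: `w = P_N U` and `U` is level `N`
  have htr : Torus.fourierTruncate N (U.1 : UnitAddTorus (Fin 3) → EuclideanSpace ℝ (Fin 3)) =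
      fun x => ∑ a, c a • Torus.frameFieldIdx N a x :=
    eq_of_ae_eq_of_continuous (Torus.isSmooth_fourierTruncate N _).continuous hw.1.continuous
      ((CubicParityLoud.Negative.fourierTruncate_ae_eq_of_isLevel hUl).trans hUw)
  have hgrad : ∫ x, ⟪∑ a, c a • Torus.frameFieldIdx N a x,
      Torus.laplacian (fun x => ∑ a, c a • Torus.frameFieldIdx N a x) x⟫_ℝ =
        -(Torus.eGradNormSq (U.1 : UnitAddTorus (Fin 3) → EuclideanSpace ℝ (Fin 3))).toReal := by
    have h1 : ∫ x, ⟪∑ a, c a • Torus.frameFieldIdx N a x,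
        Torus.laplacian (fun x => ∑ a, c a • Torus.frameFieldIdx N a x) x⟫_ℝ =
          ∫ x, ⟪(U.1 : UnitAddTorus (Fin 3) → EuclideanSpace ℝ (Fin 3)) x,
            Torus.laplacian (fun x => ∑ a, c a • Torus.frameFieldIdx N a x) x⟫_ℝ :=
      integral_congr_ae (hUw.mono fun x hx => by simp only [hx])
    have h2 := Torus.integral_inner_laplacian_fourierTruncate hv1 N
    rw [CubicParityLoud.Negative.eGradNormSq_fourierTruncate_of_isLevel hUl, htr] at h2
    exact h1.trans h2
  -- Poincaré
  have hfin := (CubicParityLoud.Negative.eGradNormSq_lt_top_of_isLevel hUl).ne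
  rw [hP, hD, hgrad, neg_neg]
  exact Torus.norm_sq_le_toReal_eGradNormSq U hfin

/-- **The tested generator of a polynomial observable at a synthesis, in frame coordinates**:
`⟨F_ν(U c), ∇p(U c)⟩ = ∑ₐ ∂ₐĥ(c) ⟨F_ν(U c), e_a⟩` with `ĥ(c) = P(G c)` (the differential of `p`
lies in the frame span, `sum_smul_bandTest_eq_sum_frame`; linearity of the tested generator in the
test; chain rule `fderiv_eval_linear`). [folklore] -/
theorem nsGeneratorPairing_polyGrad_synthesis (ν : ℝ) {N m : ℕ}
    {g : Fin m → UnitAddTorus (Fin 3) → EuclideanSpace ℝ (Fin 3)} (hg : ∀ i, IsBandTest N (g i))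
    (P : MvPolynomial (Fin m) ℝ) {U : Torus.energySpace (Fin 3)} {c : Torus.FrameIdx (Fin 3) N → ℝ}
    (hU : (U.1 : UnitAddTorus (Fin 3) → EuclideanSpace ℝ (Fin 3)) =ᵐ[volume]
      fun x => ∑ a, c a • Torus.frameFieldIdx N a x) :
    Torus.nsGeneratorPairing (d := Fin 3) ν 0 U (polyGrad g P U) =
      ∑ a, fderiv ℝ (fun c : Torus.FrameIdx (Fin 3) N → ℝ => MvPolynomial.eval
          (fun j => ∑ b, c b * ∫ y, ⟪g j y, Torus.frameFieldIdx N b y⟫_ℝ) P) c (Pi.single a 1) *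
        Torus.nsGeneratorPairing (d := Fin 3) ν 0 U (Torus.frameFieldIdx N a) := by
  have he := frameFieldIdx_band N
  have hgb : ∀ i, Torus.IsSmooth (g i) ∧ Torus.IsDivFree (g i) ∧ Torus.HasZeroMean (g i) ∧
      ∀ k ∉ (Torus.freqBall N).erase (0 : Fin 3 → ℤ),
        UnitAddTorus.mFourierCoeff (EuclideanSpace.complexify ∘ (g i)) k = 0 := hg
  have hpair : ∀ j, Torus.pairing U.1 (g j) = ∑ b, c b * ∫ y, ⟪g j y, Torus.frameFieldIdx N b y⟫_ℝ :=
    fun j => by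
      rw [SignLemma.pairing_eq_integral_of_ae hU,
        SignLemma.integral_inner_synthesis_left c (fun a => (he a).1.continuous) (hgb j).1.continuous]
  unfold polyGrad
  rw [show (fun j => Torus.pairing U.1 (g j)) =
      fun j => ∑ b, c b * ∫ y, ⟪g j y, Torus.frameFieldIdx N b y⟫_ℝ from funext hpair,
    funext fun x => SignLemma.sum_smul_bandTest_eq_sum_frame hgb _ x,
    Torus.nsGeneratorPairing_sum_smul ν (integrable_zero _ _ _) U Finset.univ _ fun a _ => (he a).1]
  refine Finset.sum_congr rfl fun a _ => ?_
  rw [(SignLemma.fderiv_eval_linear (fun i a => ∫ y, ⟪g i y, Torus.frameFieldIdx N a y⟫_ℝ) P).2 c a]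

end NoTowerDictionary

open NoTowerDictionary SignLemma in
/-- **T-dict — the frame dictionary: the calculus core implies `stub_noDissipativeTower`.**
In the frame coordinates of the landed sign lemma (`exists_frame_synthesis`, `frameFieldIdx_band`,
`fderiv_eval_linear`, `fderiv_quadratic`; `hrow`, `hkey`, `hdiv`, `htan` verbatim from the proof of
`stub_signLemma`) with, in addition, the viscous rows `nsGeneratorPairing ν 0 (U c) (e_a) = Vₐ c +
ν ∑_b D a b c_b`, `D a b = ∫⟪Δe_a, e_b⟫`, the coercivity `4π² ∑ Π a b cₐ c_b ≤ -∑ D a b cₐ c_b`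
(Poincaré, `Π` the Gram matrix of the frame) and Euler's identity through `Π` (Parseval reconstruction
of the band tests + `MvPolynomial.IsHomogeneous.sum_X_mul_pderiv`), the hypotheses of T are the
hypotheses of the core at `(h, q̂/ν, V, D, Π, 4π², 3)`, and `h ≡ 0` transports to level-`N` fields.
[folklore] -/
theorem stub_noTowerDictionary :
    (∀ {ι : Type} [Fintype ι] [DecidableEq ι] (h q : (ι → ℝ) → ℝ) (V : ι → (ι → ℝ) → ℝ)
      (D P : ι → ι → ℝ) (κ : ℝ) (d : ℕ),
      ContDiff ℝ 1 h → ContDiff ℝ 1 q → (∀ a, ContDiff ℝ 1 (V a)) →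
      (∀ c, ∑ a, fderiv ℝ (V a) c (Pi.single a 1) = 0) →
      (∀ c : ι → ℝ, ∑ a, c a * V a c = 0) →
      0 < κ → 1 ≤ d →
      (∀ c : ι → ℝ, κ * ∑ a, ∑ b, P a b * c a * c b ≤ -∑ a, ∑ b, D a b * c a * c b) →
      (∀ c : ι → ℝ, ∑ a, (∑ b, P a b * c b) * fderiv ℝ h c (Pi.single a 1) = (d : ℝ) * h c) →
      (∀ c, ∑ a, fderiv ℝ h c (Pi.single a 1) * V a c = 0) →
      (∀ c : ι → ℝ, ∑ a, fderiv ℝ q c (Pi.single a 1) * V a c =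
        ∑ a, fderiv ℝ h c (Pi.single a 1) * ∑ b, D a b * c b) →
      ∀ c, h c = 0) →
    ∀ (N : ℕ) (ν : ℝ), ν ≠ 0 →
    ∀ (m : ℕ) (g : Fin m → UnitAddTorus (Fin 3) → EuclideanSpace ℝ (Fin 3))
      (P : MvPolynomial (Fin m) ℝ), (∀ i, IsBandTest N (g i)) → P.IsHomogeneous 3 →
      (∀ u : Torus.energySpace (Fin 3), IsLevel N u →
        Torus.nsGeneratorPairing (d := Fin 3) 0 0 u (polyGrad g P u) = 0) →
    ∀ (m' : ℕ) (g' : Fin m' → UnitAddTorus (Fin 3) → EuclideanSpace ℝ (Fin 3))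
      (Q : MvPolynomial (Fin m') ℝ), (∀ i, IsBandTest N (g' i)) →
      (∀ u : Torus.energySpace (Fin 3), IsLevel N u →
        Torus.nsGeneratorPairing (d := Fin 3) 0 0 u (polyGrad g' Q u) =
          Torus.nsGeneratorPairing (d := Fin 3) ν 0 u (polyGrad g P u)) →
    ∀ u : Torus.energySpace (Fin 3), IsLevel N u →
      MvPolynomial.eval (fun j => Torus.pairing u.1 (g j)) P = 0 := by
  intro hcore N ν hν m g P hg hP hcas m' g' Q hg' htow u hu
  -- the frame, the synthesis map, the coupling constants (as in `stub_signLemma`)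
  have he := frameFieldIdx_band N
  have hw := sum_smul_frameFieldIdx_band N
  have hgb : ∀ i, Torus.IsSmooth (g i) ∧ Torus.IsDivFree (g i) ∧ Torus.HasZeroMean (g i) ∧
      ∀ k ∉ (Torus.freqBall N).erase (0 : Fin 3 → ℤ),
        UnitAddTorus.mFourierCoeff (EuclideanSpace.complexify ∘ (g i)) k = 0 := hg
  obtain ⟨U, hU⟩ := exists_frame_synthesis N
  set e : Torus.FrameIdx (Fin 3) N → UnitAddTorus (Fin 3) → EuclideanSpace ℝ (Fin 3) :=
    Torus.frameFieldIdx N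
  set G : Fin m → Torus.FrameIdx (Fin 3) N → ℝ := fun i a => ∫ y, ⟪g i y, e a y⟫_ℝ
  set G' : Fin m' → Torus.FrameIdx (Fin 3) N → ℝ := fun i a => ∫ y, ⟪g' i y, e a y⟫_ℝ
  set T : Torus.FrameIdx (Fin 3) N → Torus.FrameIdx (Fin 3) N → Torus.FrameIdx (Fin 3) N → ℝ :=
    fun a b b' => ∫ x, ⟪e b x, Torus.convect (e b') (e a) x⟫_ℝ with hT
  set h : (Torus.FrameIdx (Fin 3) N → ℝ) → ℝ :=
    fun c => MvPolynomial.eval (fun j => ∑ b, c b * G j b) P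
  set qh : (Torus.FrameIdx (Fin 3) N → ℝ) → ℝ :=
    fun c => MvPolynomial.eval (fun j => ∑ b, c b * G' j b) Q
  set V : Torus.FrameIdx (Fin 3) N → (Torus.FrameIdx (Fin 3) N → ℝ) → ℝ :=
    fun a c => ∑ b, ∑ b', c b * c b' * T a b b'
  set D : Torus.FrameIdx (Fin 3) N → Torus.FrameIdx (Fin 3) N → ℝ :=
    fun a b => ∫ x, ⟪Torus.laplacian (e a) x, e b x⟫_ℝ
  set Pg : Torus.FrameIdx (Fin 3) N → Torus.FrameIdx (Fin 3) N → ℝ :=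
    fun a b => ∫ x, ⟪e a x, e b x⟫_ℝ
  -- (1) pairings, Euler rows and VISCOUS rows at the synthesis `U c`
  have hpair : ∀ c j, Torus.pairing (U c).1 (g j) = ∑ b, c b * G j b := fun c j => by
    rw [pairing_eq_integral_of_ae (hU c).1,
      integral_inner_synthesis_left c (fun a => (he a).1.continuous) (hgb j).1.continuous]
  have hrow : ∀ c a, Torus.nsGeneratorPairing (d := Fin 3) 0 0 (U c) (e a) = V a c := fun c a => by
    rw [nsGeneratorPairing_zero_zero_eq_integral (hU c).1 (he a).1]
    exact integral_inner_synthesis_convect c (fun a => (he a).1) (he a).1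
  have hrowν : ∀ c a, Torus.nsGeneratorPairing (d := Fin 3) ν 0 (U c) (e a) =
      V a c + ν * ∑ b, D a b * c b := fun c a => by
    rw [nsGeneratorPairing_visc_synthesis ν c (fun b => (he b).1) (hU c).1 (he a).1, hrow c a]
    congr 2
    exact Finset.sum_congr rfl fun b _ => mul_comm _ _
  -- (2) the Euler derivatives at `U c` are `∇h · V`, `∇q̂ · V`; the viscous one is `∇h · (V + ν D c)`
  have hkey : ∀ c, Torus.nsGeneratorPairing (d := Fin 3) 0 0 (U c) (polyGrad g P (U c)) =
      ∑ a, fderiv ℝ h c (Pi.single a 1) * V a c := fun c => by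
    rw [nsGeneratorPairing_polyGrad_synthesis 0 hg P (hU c).1]
    exact Finset.sum_congr rfl fun a _ => by rw [hrow c a]
  have hkey' : ∀ c, Torus.nsGeneratorPairing (d := Fin 3) 0 0 (U c) (polyGrad g' Q (U c)) =
      ∑ a, fderiv ℝ qh c (Pi.single a 1) * V a c := fun c => by
    rw [nsGeneratorPairing_polyGrad_synthesis 0 hg' Q (hU c).1]
    exact Finset.sum_congr rfl fun a _ => by rw [hrow c a]
  have hkeyν : ∀ c, Torus.nsGeneratorPairing (d := Fin 3) ν 0 (U c) (polyGrad g P (U c)) =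
      ∑ a, fderiv ℝ h c (Pi.single a 1) * (V a c + ν * ∑ b, D a b * c b) := fun c => by
    rw [nsGeneratorPairing_polyGrad_synthesis ν hg P (hU c).1]
    exact Finset.sum_congr rfl fun a _ => by rw [hrowν c a]
  -- (3) the drift is divergence free and tangent to spheres (verbatim from `stub_signLemma`)
  have hTself : ∀ a b, T a b a = 0 := fun a b => by
    simp only [hT]
    refine (integral_congr_ae (ae_of_all _ fun x => ?_)).trans (integral_zero _ _)
    change ⟪e b x, Torus.convect (e a) (e a) x⟫_ℝ = (0 : ℝ)
    rw [show Torus.convect (e a) (e a) x = 0 from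
      convect_frameField_self (Torus.ne_zero_of_mem_freqBall₀ a.1) a.2.1 a.2.2 x, inner_zero_right]
  have hTdiag : ∀ a b', T a a b' = 0 := fun a b' =>
    integral_inner_convect_eq_zero (he b').1 (he b').2.1 (he a).1
  have hdiv : ∀ c, ∑ a, fderiv ℝ (V a) c (Pi.single a 1) = 0 := fun c =>
    Finset.sum_eq_zero fun a _ => by
      rw [(fderiv_quadratic (T a)).2 c a]
      simp only [hTself, hTdiag, mul_zero, Finset.sum_const_zero, add_zero]
  have htan : ∀ c : Torus.FrameIdx (Fin 3) N → ℝ, ∑ a, c a * V a c = 0 := fun c => by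
    simp_rw [← hrow c]
    rw [← Torus.nsGeneratorPairing_sum_smul 0 (integrable_zero _ _ _) (U c) Finset.univ c
      fun a _ => (he a).1, nsGeneratorPairing_zero_zero_eq_integral (hU c).1 (hw c).1]
    exact integral_inner_convect_eq_zero (hw c).1 (hw c).2.1 (hw c).1
  -- (4) the hypotheses of the core at `(h, q̂/ν, V, D, Π, 4π², 3)`
  have hh : ContDiff ℝ 1 h := (fderiv_eval_linear G P).1
  have hqh : ContDiff ℝ 1 qh := (fderiv_eval_linear G' Q).1
  have hq : ContDiff ℝ 1 (fun c => ν⁻¹ * qh c) := contDiff_const.mul hqh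
  have hV : ∀ a, ContDiff ℝ 1 (V a) := fun a => (fderiv_quadratic (T a)).1
  have hcas' : ∀ c, ∑ a, fderiv ℝ h c (Pi.single a 1) * V a c = 0 := fun c => by
    rw [← hkey c]
    exact hcas (U c) (hU c).2
  have hPgG : ∀ i b, ∑ a, Pg a b * G i a = G i b := fun i b => sum_gram_mul_coupling N (hgb i) b
  have heuler : ∀ c : Torus.FrameIdx (Fin 3) N → ℝ,
      ∑ a, (∑ b, Pg a b * c b) * fderiv ℝ h c (Pi.single a 1) = ((3 : ℕ) : ℝ) * h c :=
    fun c => sum_gram_mul_fderiv_eval G Pg hPgG hP c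
  have hcoer : ∀ c : Torus.FrameIdx (Fin 3) N → ℝ,
      4 * Real.pi ^ 2 * ∑ a, ∑ b, Pg a b * c a * c b ≤ -∑ a, ∑ b, D a b * c a * c b :=
    fun c => frame_coercive N c (hU c).1 (hU c).2
  have htower : ∀ c : Torus.FrameIdx (Fin 3) N → ℝ,
      ∑ a, fderiv ℝ (fun c => ν⁻¹ * qh c) c (Pi.single a 1) * V a c =
        ∑ a, fderiv ℝ h c (Pi.single a 1) * ∑ b, D a b * c b := by
    intro c
    have hsplit : ∑ a, fderiv ℝ h c (Pi.single a 1) * (V a c + ν * ∑ b, D a b * c b) =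
        ∑ a, fderiv ℝ h c (Pi.single a 1) * V a c +
          ν * ∑ a, fderiv ℝ h c (Pi.single a 1) * ∑ b, D a b * c b := by
      rw [Finset.mul_sum, ← Finset.sum_add_distrib]
      exact Finset.sum_congr rfl fun a _ => by ring
    have h1 : ∑ a, fderiv ℝ qh c (Pi.single a 1) * V a c =
        ν * ∑ a, fderiv ℝ h c (Pi.single a 1) * ∑ b, D a b * c b := by
      rw [← hkey' c, htow (U c) (hU c).2, hkeyν c, hsplit, hcas' c, zero_add]
    have hdq : ∀ a, fderiv ℝ (fun c => ν⁻¹ * qh c) c (Pi.single a 1) =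
        ν⁻¹ * fderiv ℝ qh c (Pi.single a 1) := fun a => by
      rw [fderiv_const_mul (hqh.differentiable_one c) ν⁻¹]
      rfl
    calc ∑ a, fderiv ℝ (fun c => ν⁻¹ * qh c) c (Pi.single a 1) * V a c
        = ν⁻¹ * ∑ a, fderiv ℝ qh c (Pi.single a 1) * V a c := by
          rw [Finset.mul_sum]
          exact Finset.sum_congr rfl fun a _ => by rw [hdq a, mul_assoc]
      _ = _ := by rw [h1, ← mul_assoc, inv_mul_cancel₀ hν, one_mul]
  have hzero : ∀ c, h c = 0 :=
    hcore h (fun c => ν⁻¹ * qh c) V D Pg (4 * Real.pi ^ 2) 3 hh hq hV hdiv htan (by positivity)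
      (by norm_num) hcoer heuler hcas' htower
  -- (5) transport to `u`: `u` and `U c(u)` have the same representative `∑ (u, e_a) e_a`
  set cu : Torus.FrameIdx (Fin 3) N → ℝ := fun a => Torus.pairing u.1 (e a)
  have hu_ae := coe_ae_eq_sum_frame_of_level u hu
  have hp : (fun j => Torus.pairing u.1 (g j)) = fun j => ∑ b, cu b * G j b := by
    funext j
    rw [← hpair cu j, pairing_eq_integral_of_ae hu_ae, pairing_eq_integral_of_ae (hU cu).1]
  rw [hp]
  exact hzero cu

end Summit.AnomalousDissipation.AnomalousDissipation.Theorems.QuarticLadderQuarticGate
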